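import Summits.Ventures.LatticeQCDFlow.Scaling.FiniteOddsMixingTime
import Summits.Ventures.LatticeQCDFlow.Scaling.LumpedStarIrreducible
import Summits.Ventures.LatticeQCDFlow.Scaling.StepChainMixingTime
import Literature.Probability.MarkovChains.CountingBound

/-!
HONEST FRAMING: exact (Metropolis-corrected) sampling algorithms for lattice gauge theory; figures
of merit are autocorrelation/cost numbers at stated couplings and volumes; no continuum-physics
claim.

# LumpedStarStepMixingTime — OPEN-MATH ITEM 1 (i) (b) «CYCLE → STEP», SPECTRAL ROUTE, CLOSED UP TO `log(1/π_min)`: THE STEP CHAIN OF THE LUMPED STAR (ONE SWAP ATTEMPT W.P. `σ`, A REDRAW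
# W.P. `1−σ`) HAS `t_mix(ε) ≤ ⌈(½log(1/π_min) + log(1/(2ε)))/((1−σ)ρ)⌉` STEPS, `ρ(c+2K+2) ≤ 2σpE_{μ_0}[Wθ]` THE RATE OF THE CYCLE LAW W27 (lean-2 GEN-38, ours)

Venture-side (OURS).  Cell `lqcd-flow` (pub-lqcd), unit `pub-lqcd-lean-2-g38`, 2026-08-30.  Chapter X (item 1 (i) (b)), file 6 = the assembly: chapter W's law (W27 `finiteOdds_worstTvDist_le`,
decay `θ = 1−ρ` of the refresh-cycle chain `P`), file X5 (`P = UB`, `A`, `B` reversible w.r.t. `π_S`, `B² = B`, `U` the resolvent of `A`), file X7 (irreducibility), files X1–X4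
(`λ⋆(S) ≤ 1 − (1−σ)ρ`, LPW Thm 12.4 through the tree).  Hypotheses: those of W27, the step objects of X5 by their equations, `μ_0 > 0`, `ρ > 0` (irreducibility of the step chain is file X7).  Hypothesis-equations, no definitions.

## What is proved

* `lumpedStar_piS_pos`, `lumpedStar_piS_sum`, `lumpedStar_cycle_stationary`, **`lumpedStar_step_mixingTime_le`**, `lumpedStar_step_mixingTime_le_twoK`.

Reading (no numerics implied): with `c = 2K+2`, `ρ = σp̄/(2K+2)` this is `t_mix^{steps}(ε) ≤ ⌈((2K+2)/(σ(1−σ)p̄))·(½log(1/π_min) + log(1/(2ε)))⌉` — the conjectured step order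
`K/(σ(1−σ)p̄)` up to `log(1/π_min) = O(K·log(1/min μ_0W))` in place of `log K`; the sharp logarithm is route (β) of the OPEN-MATH GEN-38 addendum (Conjecture W′).  Literature grade
(cell rule): LPW Thm 12.4 / Lemmas 12.1–12.3 through the tree's Literature files; nothing new cited; no new bib keys.
-/

open Finset
open Literature.Probability.MarkovChains

namespace Summit.Ventures.LatticeQCDFlow.Scaling

section StarStepLaw
variable {X : Type*} [Fintype X] [DecidableEq X] {S : Type*} [Fintype S] [DecidableEq S]
variable {hub : X → S} {comp : X → S → ℕ} {K : ℕ} {μ0 W θ : S → ℝ} {p σ ρ C c : ℝ} {acc : S → S → ℝ} {Kh : (S → ℕ) → S → S → ℝ}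
variable {u ut : X → S → ℝ} {qt q : X → X → S → S → ℝ}
variable {P : X → X → ℝ} {Q : Matrix (X × X) (X × X) ℝ} {Δ : (S → ℕ) → (S → ℕ) → ℕ} {F Ψ : X × X → ℝ}
variable {NCf : X → X → S → ℕ} {af bf : X → X → S} {PXf PYf : X → X → Option S → Option S → ℝ} {xtf ytf xsf ysf : X → X → Option S → ℝ}
variable {g : (S → ℕ) → ℝ} {πS : X → ℝ} {Z : ℝ}

omit [DecidableEq X] [DecidableEq S] in
/-- `π_S > 0` (`μ_0, W > 0`, the hub content is present). [ours] -/
theorem lumpedStar_piS_pos [Nonempty X] (hhub : ∀ x, comp x (hub x) ≠ 0) (hW : ∀ v, 0 < W v) (hμpos : ∀ v, 0 < μ0 v)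
    (hg : ∀ N, g N = ∏ v, (μ0 v * W v) ^ (N v) / ((N v).factorial : ℝ))
    (hZ : Z = ∑ x, g (comp x) * ((comp x (hub x) : ℝ) / W (hub x))) (hπS : ∀ x, πS x = g (comp x) * ((comp x (hub x) : ℝ) / W (hub x)) / Z) :
    ∀ x, 0 < πS x := by
  have hgpos : ∀ N, 0 < g N := fun N => by
    rw [hg]; exact prod_pos fun v _ => div_pos (pow_pos (mul_pos (hμpos v) (hW v)) _) (by exact_mod_cast Nat.factorial_pos _)
  have hterm : ∀ x, 0 < g (comp x) * ((comp x (hub x) : ℝ) / W (hub x)) := fun x =>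
    mul_pos (hgpos _) (div_pos (by exact_mod_cast Nat.pos_of_ne_zero (hhub x)) (hW _))
  have hZpos : 0 < Z := by rw [hZ]; exact sum_pos (fun x _ => hterm x) univ_nonempty
  intro x; rw [hπS]; exact div_pos (hterm x) hZpos

omit [DecidableEq X] [DecidableEq S] in
/-- `Σ π_S = 1`. [ours] -/
theorem lumpedStar_piS_sum [Nonempty X] (hhub : ∀ x, comp x (hub x) ≠ 0) (hW : ∀ v, 0 < W v) (hμpos : ∀ v, 0 < μ0 v)
    (hg : ∀ N, g N = ∏ v, (μ0 v * W v) ^ (N v) / ((N v).factorial : ℝ))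
    (hZ : Z = ∑ x, g (comp x) * ((comp x (hub x) : ℝ) / W (hub x))) (hπS : ∀ x, πS x = g (comp x) * ((comp x (hub x) : ℝ) / W (hub x)) / Z) :
    ∑ x, πS x = 1 := by
  have hgpos : ∀ N, 0 < g N := fun N => by
    rw [hg]; exact prod_pos fun v _ => div_pos (pow_pos (mul_pos (hμpos v) (hW v)) _) (by exact_mod_cast Nat.factorial_pos _)
  have hZpos : 0 < Z := by
    rw [hZ]; exact sum_pos (fun x _ => mul_pos (hgpos _) (div_pos (by exact_mod_cast Nat.pos_of_ne_zero (hhub x)) (hW _))) univ_nonempty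
  rw [sum_congr rfl fun x _ => hπS x, ← sum_div, ← hZ, div_self hZpos.ne']

/-- **`π_S` is stationary for the refresh-cycle chain `P` of chapter W** (`P = UB`, `π_SU = π_S`, `π_SB = π_S`). [ours] -/
theorem lumpedStar_cycle_stationary [Nonempty X] (hinj : ∀ x x', hub x = hub x' → comp x = comp x' → x = x')
    (hsurj : ∀ (z : S) (N : S → ℕ), ∑ v, N v = K + 1 → N z ≠ 0 → ∃ x, hub x = z ∧ comp x = N) (hhub : ∀ x, comp x (hub x) ≠ 0)
    (hsum : ∀ x, ∑ v, comp x v = K + 1) (hK : 1 ≤ K) (hW : ∀ v, 0 < W v) (hacc : ∀ h v, acc h v = min 1 (W h / W v)) (hμ1 : ∑ v, μ0 v = 1) (hμpos : ∀ v, 0 < μ0 v)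
    (hσ0 : 0 ≤ σ) (hσ1 : σ < 1)
    (hKoff : ∀ N h v, h ≠ v → Kh N h v = if N h = 0 then 0 else (N v : ℝ) / K * acc h v) (hKdiag : ∀ N h, Kh N h h = 1 - ∑ v ∈ univ.erase h, Kh N h v)
    (hu : ∀ x v, u x v = (1 - σ) * (if v = hub x then (1 : ℝ) else 0) + σ * ∑ h, u x h * Kh (comp x) h v)
    (hP : ∀ x x', P x x' = ∑ a, u x a * (μ0 (hub x') * (if comp x' + Pi.single a 1 = comp x + Pi.single (hub x') 1 then (1 : ℝ) else 0)))
    {Ast Bst Ust : X → X → ℝ} {g : (S → ℕ) → ℝ} {πS : X → ℝ} {Z : ℝ}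
    (hA : ∀ x x', Ast x x' = if comp x' = comp x then Kh (comp x) (hub x) (hub x') else 0)
    (hB : ∀ x x', Bst x x' = μ0 (hub x') * (if comp x' + Pi.single (hub x) 1 = comp x + Pi.single (hub x') 1 then 1 else 0))
    (hUst : ∀ x x', Ust x x' = if comp x' = comp x then u x (hub x') else 0)
    (hg : ∀ N, g N = ∏ v, (μ0 v * W v) ^ (N v) / ((N v).factorial : ℝ))
    (hZ : Z = ∑ x, g (comp x) * ((comp x (hub x) : ℝ) / W (hub x))) (hπS : ∀ x, πS x = g (comp x) * ((comp x (hub x) : ℝ) / W (hub x)) / Z) :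
    IsStationary πS P := by
  classical
  have hπ := lumpedStar_piS_pos hhub hW hμpos hg hZ hπS
  have hA0 : ∀ x x', 0 ≤ Ast x x' := starStep_swap_nonneg hW hacc hK hsum hKoff hKdiag hA
  have hA1 : ∀ x, ∑ x', Ast x x' = 1 := starStep_swap_rowsum hinj hsurj hhub hsum hKoff hKdiag hA
  have hArev : ∀ x x', πS x * Ast x x' = πS x' * Ast x' x := starStep_swap_reversible hinj hhub hW hacc hKoff hA hπS
  have hB1 : ∀ x, ∑ x', Bst x x' = 1 := starStep_redraw_rowsum hinj hsurj hhub hsum hμ1 hB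
  have hBrev : ∀ x x', πS x * Bst x x' = πS x' * Bst x' x := starStep_redraw_reversible hhub hW hg hπS hB
  have hUcol : ∀ x y, Ust x y = (1 - σ) * (if x = y then 1 else 0) + σ * ∑ z, Ast x z * Ust z y :=
    starStep_resolvent_col hinj hsurj hhub hW hacc hK hsum hKoff hKdiag hσ0 hσ1 hu hA hUst
  have hC : ∀ x y, P x y = ∑ z, Ust x z * Bst z y := fun x y =>
    (starStep_cycle_eq hinj hsurj hhub hW hacc hK hsum hKoff hKdiag hσ0 hσ1 hu hB hUst hP x y).symm
  have hstU : ∀ y, ∑ x, πS x * Ust x y = πS y := resolventKernel_stationary hπ hA0 hA1 hArev hσ0 hσ1 hUcol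
  have hstB : ∀ y, ∑ x, πS x * Bst x y = πS y := fun y => by
    rw [sum_congr rfl fun x _ => hBrev x y, ← mul_sum, hB1, mul_one]
  intro y
  calc ∑ x, πS x * P x y = ∑ x, ∑ z, πS x * Ust x z * Bst z y := sum_congr rfl fun x _ => by rw [hC, mul_sum]; exact sum_congr rfl fun z _ => by ring
    _ = ∑ z, (∑ x, πS x * Ust x z) * Bst z y := by rw [sum_comm]; exact sum_congr rfl fun z _ => by rw [sum_mul]
    _ = ∑ z, πS z * Bst z y := sum_congr rfl fun z _ => by rw [hstU z]
    _ = πS y := hstB y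

/-- **THE MIXING TIME OF THE LUMPED STAR IN STEPS.** [ours] -/
theorem lumpedStar_step_mixingTime_le [Nonempty X] [Nontrivial X] (hinj : ∀ x x', hub x = hub x' → comp x = comp x' → x = x') (hsum : ∀ x, ∑ v, comp x v = K + 1)
    (hsurj : ∀ (z : S) (N : S → ℕ), ∑ v, N v = K + 1 → N z ≠ 0 → ∃ x, hub x = z ∧ comp x = N) (hhub : ∀ x, comp x (hub x) ≠ 0) (hK : 1 ≤ K)
    (hW : ∀ v, 0 < W v) (hp0 : 0 ≤ p) (hp : ∀ v, p * W v ≤ 1) (hθ : ∀ v, θ v = 1 / (1 + p * W v)) (hacc : ∀ h v, acc h v = min 1 (W h / W v))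
    (hμ0 : ∀ v, 0 ≤ μ0 v) (hμ1 : ∑ v, μ0 v = 1) (hc : 2 * (K : ℝ) + 2 ≤ c) (hσ0 : 0 ≤ σ) (hσ1 : σ < 1) (hρ0 : 0 ≤ ρ) (hρ : ρ ≤ 1 / 2)
    (hρc : ρ * (c + 2 * K + 2) ≤ 2 * σ * (p * ∑ v, μ0 v * (W v * θ v)))
    (hKoff : ∀ N h v, h ≠ v → Kh N h v = if N h = 0 then 0 else (N v : ℝ) / K * acc h v) (hKdiag : ∀ N h, Kh N h h = 1 - ∑ v ∈ univ.erase h, Kh N h v)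
    (hu : ∀ x v, u x v = (1 - σ) * (if v = hub x then (1 : ℝ) else 0) + σ * ∑ h, u x h * Kh (comp x) h v)
    (hut : ∀ x v, ut x v = ∑ h, u x h * Kh (comp x) h v)
    (hqt : ∀ x y a b, qt x y a b = optimalCoupling (ut x) (ut y) a b)
    (hq : ∀ x y a b, q x y a b = (1 - σ) * ((if a = hub x then (1 : ℝ) else 0) * (if b = hub y then (1 : ℝ) else 0)) + σ * qt x y a b)
    (hΔ : ∀ N N', Δ N N' = ∑ v, (N v - N' v))
    (hP : ∀ x x', P x x' = ∑ a, u x a * (μ0 (hub x') * (if comp x' + Pi.single a 1 = comp x + Pi.single (hub x') 1 then (1 : ℝ) else 0)))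
    (hQ : ∀ x y x' y', Q (x, y) (x', y') = ∑ a, ∑ b, q x y a b * (μ0 (hub x')
      * (if comp x' + Pi.single a 1 = comp x + Pi.single (hub x') 1 then (1 : ℝ) else 0))
      * ((if hub y' = hub x' then (1 : ℝ) else 0) * (if comp y' + Pi.single b 1 = comp y + Pi.single (hub y') 1 then (1 : ℝ) else 0)))
    (hF : ∀ x y, F (x, y) = c + (-(1 - σ) * θ (hub x)) + (-(1 - σ) * θ (hub y)) + ∑ v, θ v * ((comp x v : ℝ) + (comp y v : ℝ)))
    (hC' : C = 2 * ((K + 1) * (c + 2 * K + 6)))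
    (hΨ : ∀ x y, Ψ (x, y) = (Δ (comp x) (comp y) : ℝ) * F (x, y) + C * (if hub x = hub y then (0 : ℝ) else 1))
    -- the tagged data of every ORIENTED adjacent pair
    (horient : ∀ x y, hub x = hub y → Δ (comp x) (comp y) = 1 → W (bf x y) ≤ W (af x y) ∨ W (bf y x) ≤ W (af y x))
    (hcx : ∀ x y, hub x = hub y → Δ (comp x) (comp y) = 1 → W (bf x y) ≤ W (af x y) → comp x = NCf x y + Pi.single (af x y) 1)
    (hcy : ∀ x y, hub x = hub y → Δ (comp x) (comp y) = 1 → W (bf x y) ≤ W (af x y) → comp y = NCf x y + Pi.single (bf x y) 1)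
    (hPXoff : ∀ x y, hub x = hub y → Δ (comp x) (comp y) = 1 → W (bf x y) ≤ W (af x y) →
      ∀ h v, h ≠ v → PXf x y (some h) (some v) = if NCf x y h = 0 then 0 else (NCf x y v : ℝ) / K * acc h v)
    (hPXin : ∀ x y, hub x = hub y → Δ (comp x) (comp y) = 1 → W (bf x y) ≤ W (af x y) →
      ∀ h, PXf x y (some h) none = if NCf x y h = 0 then 0 else acc h (af x y) / K)
    (hPXdiag : ∀ x y, hub x = hub y → Δ (comp x) (comp y) = 1 → W (bf x y) ≤ W (af x y) →
      ∀ h, PXf x y (some h) (some h) = 1 - (∑ v ∈ univ.erase h, PXf x y (some h) (some v) + PXf x y (some h) none))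
    (hPXout : ∀ x y, hub x = hub y → Δ (comp x) (comp y) = 1 → W (bf x y) ≤ W (af x y) → ∀ v, PXf x y none (some v) = (NCf x y v : ℝ) / K * acc (af x y) v)
    (hPXstay : ∀ x y, hub x = hub y → Δ (comp x) (comp y) = 1 → W (bf x y) ≤ W (af x y) → PXf x y none none = 1 - ∑ v, PXf x y none (some v))
    (hPYoff : ∀ x y, hub x = hub y → Δ (comp x) (comp y) = 1 → W (bf x y) ≤ W (af x y) →
      ∀ h v, h ≠ v → PYf x y (some h) (some v) = if NCf x y h = 0 then 0 else (NCf x y v : ℝ) / K * acc h v)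
    (hPYin : ∀ x y, hub x = hub y → Δ (comp x) (comp y) = 1 → W (bf x y) ≤ W (af x y) →
      ∀ h, PYf x y (some h) none = if NCf x y h = 0 then 0 else acc h (bf x y) / K)
    (hPYdiag : ∀ x y, hub x = hub y → Δ (comp x) (comp y) = 1 → W (bf x y) ≤ W (af x y) →
      ∀ h, PYf x y (some h) (some h) = 1 - (∑ v ∈ univ.erase h, PYf x y (some h) (some v) + PYf x y (some h) none))
    (hPYout : ∀ x y, hub x = hub y → Δ (comp x) (comp y) = 1 → W (bf x y) ≤ W (af x y) → ∀ v, PYf x y none (some v) = (NCf x y v : ℝ) / K * acc (bf x y) v)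
    (hPYstay : ∀ x y, hub x = hub y → Δ (comp x) (comp y) = 1 → W (bf x y) ≤ W (af x y) → PYf x y none none = 1 - ∑ v, PYf x y none (some v))
    (hxtf : ∀ x y, hub x = hub y → Δ (comp x) (comp y) = 1 → W (bf x y) ≤ W (af x y) →
      ∀ t, xtf x y t = (1 - σ) * PXf x y (some (hub x)) t + σ * ∑ t', xtf x y t' * PXf x y t' t)
    (hytf : ∀ x y, hub x = hub y → Δ (comp x) (comp y) = 1 → W (bf x y) ≤ W (af x y) →
      ∀ t, ytf x y t = (1 - σ) * PYf x y (some (hub x)) t + σ * ∑ t', ytf x y t' * PYf x y t' t)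
    (hxsf : ∀ x y, hub x = hub y → Δ (comp x) (comp y) = 1 → W (bf x y) ≤ W (af x y) →
      ∀ t, xsf x y t = (1 - σ) * PXf x y none t + σ * ∑ t', xsf x y t' * PXf x y t' t)
    (hysf : ∀ x y, hub x = hub y → Δ (comp x) (comp y) = 1 → W (bf x y) ≤ W (af x y) →
      ∀ t, ysf x y t = (1 - σ) * PYf x y none t + σ * ∑ t', ysf x y t' * PYf x y t' t)
    -- the step chain of the lumped star (file X5 `LumpedStarStepChain`)
    (hρpos : 0 < ρ) (hμpos : ∀ v, 0 < μ0 v)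
    {Ast Bst Ust Sst : X → X → ℝ} {g : (S → ℕ) → ℝ} {πS : X → ℝ} {Z : ℝ}
    (hA : ∀ x x', Ast x x' = if comp x' = comp x then Kh (comp x) (hub x) (hub x') else 0)
    (hB : ∀ x x', Bst x x' = μ0 (hub x') * (if comp x' + Pi.single (hub x) 1 = comp x + Pi.single (hub x') 1 then 1 else 0))
    (hUst : ∀ x x', Ust x x' = if comp x' = comp x then u x (hub x') else 0)
    (hS : ∀ x x', Sst x x' = σ * Ast x x' + (1 - σ) * Bst x x')
    (hg : ∀ N, g N = ∏ v, (μ0 v * W v) ^ (N v) / ((N v).factorial : ℝ))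
    (hZ : Z = ∑ x, g (comp x) * ((comp x (hub x) : ℝ) / W (hub x))) (hπS : ∀ x, πS x = g (comp x) * ((comp x (hub x) : ℝ) / W (hub x)) / Z)
    {πmin : ℝ} (hmin0 : 0 < πmin) (hmin : ∀ x, πmin ≤ πS x) {ε : ℝ} (hε : 0 < ε) (hε1 : ε ≤ 1 / 2) :
    mixingTime Sst πS ε ≤ ⌈1 / ((1 - σ) * ρ) * (Real.log (1 / πmin) / 2 + Real.log (1 / (2 * ε)))⌉₊ := by
  classical
  -- positivity and normalisation of `π_S`
  have hπ := lumpedStar_piS_pos hhub hW hμpos hg hZ hπS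
  have hπ1 := lumpedStar_piS_sum hhub hW hμpos hg hZ hπS
  -- the step objects (file X5)
  have hA0 : ∀ x x', 0 ≤ Ast x x' := starStep_swap_nonneg hW hacc hK hsum hKoff hKdiag hA
  have hA1 : ∀ x, ∑ x', Ast x x' = 1 := starStep_swap_rowsum hinj hsurj hhub hsum hKoff hKdiag hA
  have hArev : ∀ x x', πS x * Ast x x' = πS x' * Ast x' x := starStep_swap_reversible hinj hhub hW hacc hKoff hA hπS
  have hB0 : ∀ x x', 0 ≤ Bst x x' := fun x x' => by rw [hB]; exact mul_nonneg (hμ0 _) (by split_ifs <;> norm_num)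
  have hB1 : ∀ x, ∑ x', Bst x x' = 1 := starStep_redraw_rowsum hinj hsurj hhub hsum hμ1 hB
  have hBrev : ∀ x x', πS x * Bst x x' = πS x' * Bst x' x := starStep_redraw_reversible hhub hW hg hπS hB
  have hBB : ∀ x x', ∑ z, Bst x z * Bst z x' = Bst x x' := starStep_redraw_idem hinj hsurj hhub hsum hμ1 hB
  have hUcol : ∀ x y, Ust x y = (1 - σ) * (if x = y then 1 else 0) + σ * ∑ z, Ast x z * Ust z y :=
    starStep_resolvent_col hinj hsurj hhub hW hacc hK hsum hKoff hKdiag hσ0 hσ1 hu hA hUst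
  have hC : ∀ x y, P x y = ∑ z, Ust x z * Bst z y := fun x y =>
    (starStep_cycle_eq hinj hsurj hhub hW hacc hK hsum hKoff hKdiag hσ0 hσ1 hu hB hUst hP x y).symm
  -- stationarity of `π_S` for the cycle chain `P = UB`
  have hstU : ∀ y, ∑ x, πS x * Ust x y = πS y := resolventKernel_stationary hπ hA0 hA1 hArev hσ0 hσ1 hUcol
  have hstB : ∀ y, ∑ x, πS x * Bst x y = πS y := fun y => by
    rw [sum_congr rfl fun x _ => hBrev x y, ← mul_sum, hB1, mul_one]
  have hstP : IsStationary πS P := by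
    intro y
    calc ∑ x, πS x * P x y = ∑ x, ∑ z, πS x * Ust x z * Bst z y := sum_congr rfl fun x _ => by rw [hC, mul_sum]; exact sum_congr rfl fun z _ => by ring
      _ = ∑ z, (∑ x, πS x * Ust x z) * Bst z y := by rw [sum_comm]; exact sum_congr rfl fun z _ => by rw [sum_mul]
      _ = ∑ z, πS z * Bst z y := sum_congr rfl fun z _ => by rw [hstU z]
      _ = πS y := hstB y
  -- chapter W's law for the cycle chain, as the decay hypothesis of file X2
  have hlaw := finiteOdds_worstTvDist_le hinj hsum hsurj hhub hK hW hp0 hp hθ hacc hμ0 hμ1 hc hσ0 hσ1 hρ0 hρ hρc hKoff hKdiag hu hut hqt hq hΔ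
    hP hQ hF hC' hΨ horient hcx hcy hPXoff hPXin hPXdiag hPXout hPXstay hPYoff hPYin hPYdiag hPYout hPYstay hxtf hytf hxsf hysf hstP (fun x => (hπ x).le) hπ1
  have hdec : ∀ n x, ∑ y, |kernelAt P n x y - πS y| ≤ 2 * (((K : ℝ) + 1) * (c + 2 * K + 2) + 2 * ((K + 1) * (c + 2 * K + 6))) * (1 - ρ) ^ n := by
    intro n x
    have h1 : ∑ y, |kernelAt P n x y - πS y| = 2 * tvDist (lawAt P (Pi.single x 1) n) πS := by
      unfold tvDist; rw [← mul_assoc]; norm_num; rfl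
    rw [h1, mul_assoc]
    exact mul_le_mul_of_nonneg_left ((tvDist_single_le_worstTvDist P πS n x).trans (hlaw n)) (by norm_num)
  have hCp0 : ∀ x y, kernelAt P 0 x y = if x = y then 1 else 0 := fun x y => by rw [kernelAt_zero_apply]; simp only [eq_comm]
  have hCpS : ∀ n x y, kernelAt P (n + 1) x y = ∑ z, kernelAt P n x z * P z y := kernelAt_succ_apply P
  have hθ0 : 0 < 1 - ρ := by linarith
  have hθ1 : 1 - ρ < 1 := by linarith
  -- `σ > 0` (from `ρ > 0` and `ρ(c+2K+2) ≤ 2σp̄`) and irreducibility (file X7)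
  have hσpos : 0 < σ := by
    by_contra hσ
    have hσ0' : σ = 0 := le_antisymm (not_lt.mp hσ) hσ0
    rw [hσ0'] at hρc
    have : 0 < ρ * (c + 2 * K + 2) := mul_pos hρpos (by have : (0:ℝ) ≤ K := Nat.cast_nonneg _; linarith)
    linarith
  have hirr := lumpedStar_step_irreducible hsurj hhub hW hacc hK hsum hKoff hKdiag hμpos hσpos hσ1 hA hB hS
  have h := stepChain_mixingTime_le hπ hπ1 hA0 hA1 hArev hσ0 hσ1 hUcol hB0 hB1 hBrev hBB hC hCp0 hCpS hθ0 hθ1 hdec hS hirr hmin0 hmin hε hε1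
  have e : (1 - σ) * (1 - (1 - ρ)) = (1 - σ) * ρ := by ring
  rw [e] at h
  exact h

/-- **The step-count law at `c = 2K+2`:** `t_mix^{steps}(ε) ≤ ⌈((2K+2)/((1−σ)σp̄))·(½log(1/π_min) + log(1/(2ε)))⌉`, `p̄ = pE_{μ_0}[Wθ] > 0`, `0 < σ < 1`. [ours] -/
theorem lumpedStar_step_mixingTime_le_twoK [Nonempty X] [Nontrivial X] (hinj : ∀ x x', hub x = hub x' → comp x = comp x' → x = x') (hsum : ∀ x, ∑ v, comp x v = K + 1)
    (hsurj : ∀ (z : S) (N : S → ℕ), ∑ v, N v = K + 1 → N z ≠ 0 → ∃ x, hub x = z ∧ comp x = N) (hhub : ∀ x, comp x (hub x) ≠ 0) (hK : 1 ≤ K)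
    (hW : ∀ v, 0 < W v) (hp0 : 0 ≤ p) (hp : ∀ v, p * W v ≤ 1) (hθ : ∀ v, θ v = 1 / (1 + p * W v)) (hacc : ∀ h v, acc h v = min 1 (W h / W v))
    (hμ0 : ∀ v, 0 ≤ μ0 v) (hμ1 : ∑ v, μ0 v = 1) (hσ0 : 0 < σ) (hσ1 : σ < 1) (hgap : 0 < p * ∑ v, μ0 v * (W v * θ v))
    (hKoff : ∀ N h v, h ≠ v → Kh N h v = if N h = 0 then 0 else (N v : ℝ) / K * acc h v) (hKdiag : ∀ N h, Kh N h h = 1 - ∑ v ∈ univ.erase h, Kh N h v)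
    (hu : ∀ x v, u x v = (1 - σ) * (if v = hub x then (1 : ℝ) else 0) + σ * ∑ h, u x h * Kh (comp x) h v)
    (hut : ∀ x v, ut x v = ∑ h, u x h * Kh (comp x) h v)
    (hqt : ∀ x y a b, qt x y a b = optimalCoupling (ut x) (ut y) a b)
    (hq : ∀ x y a b, q x y a b = (1 - σ) * ((if a = hub x then (1 : ℝ) else 0) * (if b = hub y then (1 : ℝ) else 0)) + σ * qt x y a b)
    (hΔ : ∀ N N', Δ N N' = ∑ v, (N v - N' v))
    (hP : ∀ x x', P x x' = ∑ a, u x a * (μ0 (hub x') * (if comp x' + Pi.single a 1 = comp x + Pi.single (hub x') 1 then (1 : ℝ) else 0)))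
    (hQ : ∀ x y x' y', Q (x, y) (x', y') = ∑ a, ∑ b, q x y a b * (μ0 (hub x')
      * (if comp x' + Pi.single a 1 = comp x + Pi.single (hub x') 1 then (1 : ℝ) else 0))
      * ((if hub y' = hub x' then (1 : ℝ) else 0) * (if comp y' + Pi.single b 1 = comp y + Pi.single (hub y') 1 then (1 : ℝ) else 0)))
    (hF : ∀ x y, F (x, y) = (2 * (K : ℝ) + 2) + (-(1 - σ) * θ (hub x)) + (-(1 - σ) * θ (hub y)) + ∑ v, θ v * ((comp x v : ℝ) + (comp y v : ℝ)))
    (hC' : C = 2 * ((K + 1) * ((2 * (K : ℝ) + 2) + 2 * K + 6)))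
    (hΨ : ∀ x y, Ψ (x, y) = (Δ (comp x) (comp y) : ℝ) * F (x, y) + C * (if hub x = hub y then (0 : ℝ) else 1))
    -- the tagged data of every ORIENTED adjacent pair
    (horient : ∀ x y, hub x = hub y → Δ (comp x) (comp y) = 1 → W (bf x y) ≤ W (af x y) ∨ W (bf y x) ≤ W (af y x))
    (hcx : ∀ x y, hub x = hub y → Δ (comp x) (comp y) = 1 → W (bf x y) ≤ W (af x y) → comp x = NCf x y + Pi.single (af x y) 1)
    (hcy : ∀ x y, hub x = hub y → Δ (comp x) (comp y) = 1 → W (bf x y) ≤ W (af x y) → comp y = NCf x y + Pi.single (bf x y) 1)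
    (hPXoff : ∀ x y, hub x = hub y → Δ (comp x) (comp y) = 1 → W (bf x y) ≤ W (af x y) →
      ∀ h v, h ≠ v → PXf x y (some h) (some v) = if NCf x y h = 0 then 0 else (NCf x y v : ℝ) / K * acc h v)
    (hPXin : ∀ x y, hub x = hub y → Δ (comp x) (comp y) = 1 → W (bf x y) ≤ W (af x y) →
      ∀ h, PXf x y (some h) none = if NCf x y h = 0 then 0 else acc h (af x y) / K)
    (hPXdiag : ∀ x y, hub x = hub y → Δ (comp x) (comp y) = 1 → W (bf x y) ≤ W (af x y) →
      ∀ h, PXf x y (some h) (some h) = 1 - (∑ v ∈ univ.erase h, PXf x y (some h) (some v) + PXf x y (some h) none))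
    (hPXout : ∀ x y, hub x = hub y → Δ (comp x) (comp y) = 1 → W (bf x y) ≤ W (af x y) → ∀ v, PXf x y none (some v) = (NCf x y v : ℝ) / K * acc (af x y) v)
    (hPXstay : ∀ x y, hub x = hub y → Δ (comp x) (comp y) = 1 → W (bf x y) ≤ W (af x y) → PXf x y none none = 1 - ∑ v, PXf x y none (some v))
    (hPYoff : ∀ x y, hub x = hub y → Δ (comp x) (comp y) = 1 → W (bf x y) ≤ W (af x y) →
      ∀ h v, h ≠ v → PYf x y (some h) (some v) = if NCf x y h = 0 then 0 else (NCf x y v : ℝ) / K * acc h v)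
    (hPYin : ∀ x y, hub x = hub y → Δ (comp x) (comp y) = 1 → W (bf x y) ≤ W (af x y) →
      ∀ h, PYf x y (some h) none = if NCf x y h = 0 then 0 else acc h (bf x y) / K)
    (hPYdiag : ∀ x y, hub x = hub y → Δ (comp x) (comp y) = 1 → W (bf x y) ≤ W (af x y) →
      ∀ h, PYf x y (some h) (some h) = 1 - (∑ v ∈ univ.erase h, PYf x y (some h) (some v) + PYf x y (some h) none))
    (hPYout : ∀ x y, hub x = hub y → Δ (comp x) (comp y) = 1 → W (bf x y) ≤ W (af x y) → ∀ v, PYf x y none (some v) = (NCf x y v : ℝ) / K * acc (bf x y) v)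
    (hPYstay : ∀ x y, hub x = hub y → Δ (comp x) (comp y) = 1 → W (bf x y) ≤ W (af x y) → PYf x y none none = 1 - ∑ v, PYf x y none (some v))
    (hxtf : ∀ x y, hub x = hub y → Δ (comp x) (comp y) = 1 → W (bf x y) ≤ W (af x y) →
      ∀ t, xtf x y t = (1 - σ) * PXf x y (some (hub x)) t + σ * ∑ t', xtf x y t' * PXf x y t' t)
    (hytf : ∀ x y, hub x = hub y → Δ (comp x) (comp y) = 1 → W (bf x y) ≤ W (af x y) →
      ∀ t, ytf x y t = (1 - σ) * PYf x y (some (hub x)) t + σ * ∑ t', ytf x y t' * PYf x y t' t)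
    (hxsf : ∀ x y, hub x = hub y → Δ (comp x) (comp y) = 1 → W (bf x y) ≤ W (af x y) →
      ∀ t, xsf x y t = (1 - σ) * PXf x y none t + σ * ∑ t', xsf x y t' * PXf x y t' t)
    (hysf : ∀ x y, hub x = hub y → Δ (comp x) (comp y) = 1 → W (bf x y) ≤ W (af x y) →
      ∀ t, ysf x y t = (1 - σ) * PYf x y none t + σ * ∑ t', ysf x y t' * PYf x y t' t)
    -- the step chain of the lumped star (file X5 `LumpedStarStepChain`)
    (hμpos : ∀ v, 0 < μ0 v)
    {Ast Bst Ust Sst : X → X → ℝ} {g : (S → ℕ) → ℝ} {πS : X → ℝ} {Z : ℝ}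
    (hA : ∀ x x', Ast x x' = if comp x' = comp x then Kh (comp x) (hub x) (hub x') else 0)
    (hB : ∀ x x', Bst x x' = μ0 (hub x') * (if comp x' + Pi.single (hub x) 1 = comp x + Pi.single (hub x') 1 then 1 else 0))
    (hUst : ∀ x x', Ust x x' = if comp x' = comp x then u x (hub x') else 0)
    (hS : ∀ x x', Sst x x' = σ * Ast x x' + (1 - σ) * Bst x x')
    (hg : ∀ N, g N = ∏ v, (μ0 v * W v) ^ (N v) / ((N v).factorial : ℝ))
    (hZ : Z = ∑ x, g (comp x) * ((comp x (hub x) : ℝ) / W (hub x))) (hπS : ∀ x, πS x = g (comp x) * ((comp x (hub x) : ℝ) / W (hub x)) / Z)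
    {πmin : ℝ} (hmin0 : 0 < πmin) (hmin : ∀ x, πmin ≤ πS x) {ε : ℝ} (hε : 0 < ε) (hε1 : ε ≤ 1 / 2) :
    mixingTime Sst πS ε ≤ ⌈(2 * K + 2) / ((1 - σ) * σ * (p * ∑ v, μ0 v * (W v * θ v))) * (Real.log (1 / πmin) / 2 + Real.log (1 / (2 * ε)))⌉₊ := by
  have hK0 : (0 : ℝ) < 2 * K + 2 := by positivity
  have hpbar : p * ∑ v, μ0 v * (W v * θ v) ≤ 1 / 2 := by
    calc p * ∑ v, μ0 v * (W v * θ v) = ∑ v, μ0 v * (p * (W v * θ v)) := by rw [mul_sum]; exact sum_congr rfl fun v _ => by ring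
      _ ≤ ∑ v, μ0 v * (1 / 2) := sum_le_sum fun v _ => mul_le_mul_of_nonneg_left (finiteOdds_pWθ_le_half hp0 hp hW hθ v) (hμ0 v)
      _ = 1 / 2 := by rw [← sum_mul, hμ1, one_mul]
  set ρ' : ℝ := σ * (p * ∑ v, μ0 v * (W v * θ v)) / (2 * K + 2) with hρdef
  have hρ0 : 0 < ρ' := div_pos (mul_pos hσ0 hgap) hK0
  have hρhalf : ρ' ≤ 1 / 2 := by
    rw [hρdef, div_le_iff₀ hK0]
    have h2 : σ * (p * ∑ v, μ0 v * (W v * θ v)) ≤ 1 * (1 / 2) := mul_le_mul hσ1.le hpbar hgap.le zero_le_one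
    have hK1 : (1 : ℝ) ≤ K := by exact_mod_cast hK
    nlinarith
  have hρc : ρ' * ((2 * (K : ℝ) + 2) + 2 * K + 2) ≤ 2 * σ * (p * ∑ v, μ0 v * (W v * θ v)) := by
    rw [hρdef]; apply le_of_eq; field_simp; ring
  have h := lumpedStar_step_mixingTime_le hinj hsum hsurj hhub hK hW hp0 hp hθ hacc hμ0 hμ1 (c := 2 * (K : ℝ) + 2) le_rfl hσ0.le hσ1 hρ0.le hρhalf hρc hKoff hKdiag
    hu hut hqt hq hΔ hP hQ hF hC' hΨ horient hcx hcy hPXoff hPXin hPXdiag hPXout hPXstay hPYoff hPYin hPYdiag hPYout hPYstay hxtf hytf hxsf hysf hρ0 hμpos hA hB hUst hS hg hZ hπS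
    hmin0 hmin hε hε1
  have e : 1 / ((1 - σ) * ρ') = (2 * K + 2) / ((1 - σ) * σ * (p * ∑ v, μ0 v * (W v * θ v))) := by
    rw [hρdef]; field_simp
  rw [e] at h
  exact h

end StarStepLaw

end Summit.Ventures.LatticeQCDFlow.Scaling
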